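import Literature.NumberTheory.LFunctions.ZetaLogDerivRH
import Literature.Analysis.Complex.LogDerivZeros
import HarnessLib

/-!
# RH-FREE · `ζ(s)` is not small in a zero-free strip: `log |ζ(σ+it)| ≥ −A log(|t|+2)` (Titchmarsh Thm 9.6 (B), lower half; Levinson 1956 (4.1)) — nothing here bears on the truth of RH

Literature-typing tranche `rh-lit-broughan-2` (Broughan, *Equivalents of the Riemann Hypothesis*,
Vol. 2, Ch. 8 §8.5 "Levinson's Equivalence"), analytic input (4.1) of Levinson's closure theorem
[Levinson1956, §4]: «It follows easily from familiar properties of `ζ(s)` [Titchmarsh, Theorem 9.6 B]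
that if `ζ(s)` has no zeros in the strip `σ₁ < Re s < σ₂` then there is a constant `A`, which depends
on `δ`, such that if `s = σ + it` then `|ζ(s)| > (2 + |t|)^{−A}`, `σ₁ + δ ≤ σ ≤ σ₂ − δ`.» The point is
that the hypothesis is a STRIP (zeros are allowed on both sides of it), so the usual
Borel–Carathéodory bound for `log ζ` on a zero-free HALF-PLANE (Titchmarsh Thm 14.2) is not
available; one uses instead the local factorisation behind Titchmarsh's Theorem 9.6 (B),
`log ζ(s) = ∑_{|t−γ|≤1} log(s − ρ) + O(log t)`, whose real part bounds `log|ζ(s)|` from BELOW by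
`∑ log|s − ρ| − A log t`, and `|s − ρ| ≥ δ` for every zero when `s` is `δ` inside the zero-free strip.

Everything here is PROVED (standard axioms); no definitions, no named facts.

* `log_norm_ge_sum_log_of_zeros` — the lower half of Landau's lemma (Titchmarsh §3.9 Lemma α, same
  normalisation as the tree's `Literature.Analysis.Complex.norm_logDeriv_sub_sum_le`): for `f`
  holomorphic on `|z − c| ≤ R` with `f(c) ≠ 0`, `|f| ≤ B`, radii `0 < r₁ < R₂ < R`, and `z` with
  `|z − c| ≤ r₁`, `f(z) ≠ 0`:
  `log|f(z)| ≥ ∑_ρ m(ρ) log|z − ρ| + log|f(c)| − N log R₂ − 2 M r₁/(R₂ − r₁)`,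
  `M = log(B/|f(c)|) + N log(R/(R − R₂)) + 1`, the sum over the zeros `ρ` of `f` in `|z − c| ≤ R₂`
  (write `f = P·G`, `G = G(c)e^h` on `|z − c| < R₂`, `Re h ≤ log(B/|f(c)|) + N log(R/(R−R₂))` by the
  maximum principle, `|h| ≤ 2Mr₁/(R₂−r₁)` by Borel–Carathéodory, so `log|G(z)| ≥ log|G(c)| − |h(z)|`).
* `exists_log_norm_riemannZeta_ge_of_far_from_zeros` — on the tree's Jensen discs about `2 + iT`
  (`|T| ≥ 2`, `|ζ| ≤ 40(|T|+4)` on radius `19/10`, `|ζ(2+iT)| ≥ 1/3`, `N ≪ log(|T|+2)` zeros in radius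
  `37/20`): for `|z − (2+iT)| ≤ 7/4` at distance `≥ δ` (`0 < δ ≤ 1`) from every zero of `ζ` in
  `|s − (2+iT)| ≤ 37/20`, `log|ζ(z)| ≥ −A(1 + log δ⁻¹) log(|T| + 2)` with an absolute `A`.
* `exists_log_norm_riemannZeta_ge_of_zeroFree_strip` — **Levinson's (4.1) / Titchmarsh 9.6 (B)
  consequence**: if `ζ ≠ 0` on the open strip `a − δ < Re s < b + δ` (`1/4 ≤ a`, `b ≤ 15/4`,
  `0 < δ`), then `log|ζ(σ + it)| ≥ −A log(|t| + 2)` for `a ≤ σ ≤ b`, `|t| ≥ 2`.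
* `exists_norm_inv_riemannZeta_le_of_zeroFree_strip` — the same for all `t` in the form
  `|1/ζ(σ + it)| ≤ C (|t| + 2)^C` (`a ≤ σ ≤ b < 1`; compactness for `|t| ≤ 2`).

## References

* [Titchmarsh1986] E. C. Titchmarsh, *The Theory of the Riemann Zeta-Function*, 2nd ed., Oxford
  1986, §3.9 Lemma α, Theorem 9.6 (B) (and (9.6.6)).
* [Levinson1956] N. Levinson, *On closure problems and the zeros of the Riemann zeta function*,
  Proc. Amer. Math. Soc. 7 (1956) 838–845, §4 (4.1).
* [Broughan2017] K. Broughan, *Equivalents of the Riemann Hypothesis*, Vol. 2, §8.5 (secondary).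
-/

noncomputable section

open Complex Filter Set Metric MeromorphicOn Real
open scoped Topology

namespace Literature.NumberTheory.LFunctions

namespace ZetaStripLowerBound

/-! ## The lower half of Landau's lemma on a disc -/

/-- **Lower bound for `log|f|` near the zeros in a disc** (Titchmarsh §3.9 Lemma α, the estimate
`Re h ≤ M`, `|h| ≤ 2Mr₁/(R₂ − r₁)` of its proof read as a LOWER bound for `log|G| = log|G(c)| + Re h`).
Let `f` be holomorphic on `|z − c| ≤ R` with `f(c) ≠ 0` and `|f| ≤ B` there, `0 < r₁ < R₂ < R`, and let
`ρ` run over the zeros of `f` in `|z − c| ≤ R₂` with multiplicities `m(ρ)`, `N = ∑ m(ρ)`. Then for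
`|z − c| ≤ r₁` with `f(z) ≠ 0`:
`∑_ρ m(ρ) log|z − ρ| + log|f(c)| − N log R₂ − 2 M r₁/(R₂ − r₁) ≤ log|f(z)|`,
`M = log(B/|f(c)|) + N log(R/(R − R₂)) + 1`. [cite: Titchmarsh1986, §3.9 Lemma α (proof); Thm 9.6 (B)] -/
theorem log_norm_ge_sum_log_of_zeros {f : ℂ → ℂ} {c : ℂ} {r₁ R₂ R B : ℝ} (hr₁ : 0 < r₁)
    (hR₂ : r₁ < R₂) (hR : R₂ < R) (hf : AnalyticOnNhd ℂ f (closedBall c R)) (hc : f c ≠ 0)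
    (hB : ∀ z ∈ closedBall c R, ‖f z‖ ≤ B) {z : ℂ} (hz : z ∈ closedBall c r₁) (hfz : f z ≠ 0) :
    (∑ u ∈ ((divisor f (closedBall c R₂)).finiteSupport (isCompact_closedBall c R₂)).toFinset,
        (divisor f (closedBall c R₂) u : ℝ) * Real.log ‖z - u‖) + Real.log ‖f c‖
      - (∑ u ∈ ((divisor f (closedBall c R₂)).finiteSupport (isCompact_closedBall c R₂)).toFinset,
          (divisor f (closedBall c R₂) u : ℝ)) * Real.log R₂
      - 2 * (Real.log (B / ‖f c‖) +
          (∑ u ∈ ((divisor f (closedBall c R₂)).finiteSupport (isCompact_closedBall c R₂)).toFinset,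
            (divisor f (closedBall c R₂) u : ℝ)) * Real.log (R / (R - R₂)) + 1) * r₁ / (R₂ - r₁)
      ≤ Real.log ‖f z‖ := by
  classical
  have hR₂0 : 0 < R₂ := hr₁.trans hR₂
  have hR0 : 0 < R := hR₂0.trans hR
  have hRR₂ : 0 < R - R₂ := sub_pos.2 hR
  set U₂ := closedBall c R₂ with hU₂
  set D := divisor f U₂ with hD
  set S := (D.finiteSupport (isCompact_closedBall c R₂)).toFinset with hS
  set n : ℂ → ℕ := fun u ↦ (D u).toNat with hn
  set P : ℂ → ℂ := fun w ↦ ∏ u ∈ S, (w - u) ^ n u with hP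
  have hf₂ : AnalyticOnNhd ℂ f U₂ := hf.mono (closedBall_subset_closedBall hR.le)
  obtain ⟨G, hG_an, hG_ne, hfPG⟩ :=
    Literature.Analysis.Complex.exists_eq_prod_pow_sub_mul hR₂0 hR.le hf hc
  -- memberships
  have hzc : ‖z - c‖ ≤ r₁ := by rwa [mem_closedBall, dist_eq_norm] at hz
  have hz₂ : z ∈ ball c R₂ := by
    rw [mem_ball, dist_eq_norm]; linarith
  have hzU₂ : z ∈ U₂ := ball_subset_closedBall hz₂
  have hzR : z ∈ closedBall c R := closedBall_subset_closedBall hR.le hzU₂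
  have hcU₂ : c ∈ U₂ := mem_closedBall_self hR₂0.le
  have hcR : c ∈ closedBall c R := mem_closedBall_self hR0.le
  have hfc : 0 < ‖f c‖ := norm_pos_iff.2 hc
  have hBc : ‖f c‖ ≤ B := hB c hcR
  have hB0 : 0 < B := hfc.trans_le hBc
  -- multiplicities
  have hD0 : ∀ u, 0 ≤ D u := fun u ↦ hf₂.divisor_nonneg u
  have hSU : ∀ u ∈ S, u ∈ U₂ := fun u hu ↦
    D.supportWithinDomain ((Finite.mem_toFinset _).1 hu)
  have hSc : ∀ u ∈ S, ‖c - u‖ ≤ R₂ := by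
    intro u hu
    have := hSU u hu
    rw [mem_closedBall, dist_eq_norm, norm_sub_rev] at this
    exact this
  set N : ℕ := ∑ u ∈ S, n u with hN
  have hnR : ∀ u, ((n u : ℕ) : ℝ) = (D u : ℝ) := by
    intro u
    simp only [hn]
    conv_rhs => rw [← Int.toNat_of_nonneg (hD0 u)]
    exact (Int.cast_natCast _).symm
  have hNR : (N : ℝ) = ∑ u ∈ S, (D u : ℝ) := by
    rw [hN]; push_cast; exact Finset.sum_congr rfl fun u _ ↦ hnR u
  have hPnorm : ∀ w, ‖P w‖ = ∏ u ∈ S, ‖w - u‖ ^ n u := by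
    intro w
    rw [hP, norm_prod]
    exact Finset.prod_congr rfl fun u _ ↦ norm_pow _ _
  -- `D z = 0` (as `f z ≠ 0`), so `z ∉ S`
  have hDz : D z = 0 := by
    rw [hD, hf₂.divisor_apply hzU₂, ((hf₂ z hzU₂).analyticOrderAt_eq_zero).2 hfz]
    rfl
  have hzS : z ∉ S := by
    rw [hS, Finite.mem_toFinset, Function.mem_support]
    exact fun h ↦ h hDz
  have hzS' : ∀ a ∈ S, z ≠ a := fun a ha h ↦ hzS (h ▸ ha)
  have hzu0 : ∀ a ∈ S, 0 < ‖z - a‖ := fun a ha ↦ norm_pos_iff.2 (sub_ne_zero.2 (hzS' a ha))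
  -- ‖P c‖ ≤ R₂ ^ N
  have hPc : ‖P c‖ ≤ R₂ ^ N := by
    rw [hPnorm, hN, ← Finset.prod_pow_eq_pow_sum]
    refine Finset.prod_le_prod (fun u _ ↦ by positivity) fun u hu ↦ ?_
    exact pow_le_pow_left₀ (norm_nonneg _) (hSc u hu) _
  -- ‖P s‖ ≥ (R - R₂) ^ N on the sphere
  have hPs : ∀ s ∈ sphere c R, (R - R₂) ^ N ≤ ‖P s‖ := by
    intro s hs
    rw [mem_sphere, dist_eq_norm] at hs
    rw [hPnorm, hN, ← Finset.prod_pow_eq_pow_sum]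
    refine Finset.prod_le_prod (fun u _ ↦ by positivity) fun u hu ↦ ?_
    refine pow_le_pow_left₀ hRR₂.le ?_ _
    have h1 := norm_sub_norm_le (s - c) (u - c)
    rw [show s - c - (u - c) = s - u by ring, hs, norm_sub_rev u c] at h1
    linarith [hSc u hu]
  -- G on the sphere
  set C₀ : ℝ := B / (R - R₂) ^ N with hC₀
  have hGs : ∀ s ∈ sphere c R, ‖G s‖ ≤ C₀ := by
    intro s hs
    have hsR : s ∈ closedBall c R := sphere_subset_closedBall hs
    have hPs' := hPs s hs
    have hPs0 : 0 < ‖P s‖ := lt_of_lt_of_le (pow_pos hRR₂ N) hPs'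
    have h1 : ‖f s‖ = ‖P s‖ * ‖G s‖ := by rw [hfPG s hsR, norm_mul]
    rw [hC₀, le_div_iff₀ (pow_pos hRR₂ N)]
    calc ‖G s‖ * (R - R₂) ^ N ≤ ‖G s‖ * ‖P s‖ :=
          mul_le_mul_of_nonneg_left hPs' (norm_nonneg _)
      _ = ‖f s‖ := by rw [h1, mul_comm]
      _ ≤ B := hB s hsR
  -- maximum modulus
  have hGd : DifferentiableOn ℂ G (closedBall c R) := hG_an.differentiableOn
  have hGmax : ∀ w ∈ closedBall c R, ‖G w‖ ≤ C₀ := by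
    intro w hw
    refine Complex.norm_le_of_forall_mem_frontier_norm_le (U := ball c R) isBounded_ball ?_ ?_ ?_
    · apply DifferentiableOn.diffContOnCl
      rwa [closure_ball c hR0.ne']
    · rwa [frontier_ball c hR0.ne']
    · rwa [closure_ball c hR0.ne']
  -- ‖G c‖ ≥ ‖f c‖ / R₂ ^ N
  have hGc0 : G c ≠ 0 := hG_ne c hcU₂
  have hGcpos : 0 < ‖G c‖ := norm_pos_iff.2 hGc0
  have hGc : ‖f c‖ ≤ R₂ ^ N * ‖G c‖ := by
    rw [hfPG c hcR, norm_mul]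
    exact mul_le_mul_of_nonneg_right hPc (norm_nonneg _)
  -- the exponent M
  set M₀ : ℝ := Real.log (B / ‖f c‖) + N * Real.log (R / (R - R₂)) with hM₀
  set M : ℝ := M₀ + 1 with hM
  have hlog1 : 0 ≤ Real.log (B / ‖f c‖) := Real.log_nonneg ((one_le_div hfc).2 hBc)
  have hlog2 : 0 ≤ Real.log (R / (R - R₂)) :=
    Real.log_nonneg ((one_le_div hRR₂).2 (by linarith))
  have hM₀0 : 0 ≤ M₀ := by positivity
  have hMpos : 0 < M := by linarith
  have hexpM₀ : Real.exp M₀ = B / ‖f c‖ * (R / (R - R₂)) ^ N := by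
    rw [hM₀, Real.exp_add, Real.exp_log (div_pos hB0 hfc), ← Real.log_pow,
      Real.exp_log (pow_pos (div_pos hR0 hRR₂) N)]
  have hC₀le : C₀ ≤ Real.exp M₀ * ‖G c‖ := by
    rw [hexpM₀, hC₀]
    have hGc' : ‖f c‖ / R₂ ^ N ≤ ‖G c‖ := by
      rw [div_le_iff₀ (pow_pos hR₂0 N)]; linarith
    calc B / (R - R₂) ^ N = B / ‖f c‖ * (R / (R - R₂)) ^ N * (‖f c‖ / R ^ N) := by
          field_simp
          rw [← mul_pow, mul_div_cancel₀ _ hRR₂.ne']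
        _ ≤ B / ‖f c‖ * (R / (R - R₂)) ^ N * (‖f c‖ / R₂ ^ N) := by
          gcongr
        _ ≤ B / ‖f c‖ * (R / (R - R₂)) ^ N * ‖G c‖ := by
          gcongr
  have hGle : ∀ w ∈ closedBall c R, ‖G w‖ ≤ Real.exp M₀ * ‖G c‖ := fun w hw ↦
    (hGmax w hw).trans hC₀le
  -- the holomorphic logarithm h of G/G(c) on the ball |w - c| < R₂
  have hG_ne' : ∀ w ∈ ball c R₂, G w ≠ 0 := fun w hw ↦ hG_ne w (ball_subset_closedBall hw)
  have hGan' : ∀ w ∈ ball c R₂, AnalyticAt ℂ G w := fun w hw ↦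
    hG_an w (closedBall_subset_closedBall hR.le (ball_subset_closedBall hw))
  have hGd' : DifferentiableOn ℂ G (ball c R₂) := fun w hw ↦
    (hGan' w hw).differentiableAt.differentiableWithinAt
  obtain ⟨h, hhd, hh0, hh, hGexp⟩ := Literature.Analysis.Complex.exists_log_on_ball hGd' hG_ne'
  -- Re h ≤ M₀ on the ball
  have hRe : ∀ w ∈ ball c R₂, (h w).re ≤ M₀ := by
    intro w hw
    have hwR : w ∈ closedBall c R := closedBall_subset_closedBall hR.le (ball_subset_closedBall hw)
    have h1 := hGle w hwR
    rw [hGexp w hw, norm_mul, Complex.norm_exp, mul_comm] at h1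
    have h2 : Real.exp (h w).re ≤ Real.exp M₀ :=
      le_of_mul_le_mul_right h1 hGcpos
    exact Real.exp_le_exp.1 h2
  -- Borel–Carathéodory: |h| ≤ 2 M r₁ / (R₂ - r₁) on |w - c| ≤ r₁
  set H : ℝ := 2 * M * r₁ / (R₂ - r₁) with hH
  have hBC : ∀ v ∈ closedBall c r₁, ‖h v‖ ≤ H := by
    intro v hv
    rw [mem_closedBall, dist_eq_norm] at hv
    set h₀ : ℂ → ℂ := fun w ↦ h (c + w) with hh₀
    have hmem : ∀ w ∈ ball (0 : ℂ) R₂, c + w ∈ ball c R₂ := by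
      intro w hw
      rw [mem_ball, dist_eq_norm] at hw ⊢
      simpa using hw
    have hd₀ : DifferentiableOn ℂ h₀ (ball 0 R₂) := by
      intro w hw
      exact ((hh (c + w) (hmem w hw)).differentiableAt.comp w
        ((differentiableAt_id).const_add c)).differentiableWithinAt
    have hmaps : MapsTo h₀ (ball 0 R₂) {z | z.re ≤ M} := by
      intro w hw
      simp only [mem_setOf_eq, hh₀]
      exact (hRe _ (hmem w hw)).trans (by linarith)
    have hv' : v - c ∈ ball (0 : ℂ) R₂ := by
      rw [mem_ball, dist_zero_right]; linarith
    have hbc := Complex.borelCaratheodory_zero hMpos hd₀ hmaps hR₂0 hv' (by simp [hh₀, hh0])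
    simp only [hh₀, add_sub_cancel] at hbc
    refine hbc.trans ?_
    rw [hH, div_le_div_iff₀ (by linarith) (by linarith)]
    have hM2 : 0 ≤ 2 * M := by linarith
    nlinarith [mul_le_mul_of_nonneg_left hv hM2, norm_nonneg (v - c)]
  -- lower bound for log ‖G z‖
  have hGz : Real.log ‖G c‖ - H ≤ Real.log ‖G z‖ := by
    have h1 : ‖G z‖ = ‖G c‖ * Real.exp (h z).re := by
      rw [hGexp z hz₂, norm_mul, Complex.norm_exp]
    rw [h1, Real.log_mul hGcpos.ne' (Real.exp_pos _).ne', Real.log_exp]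
    have h2 : -‖h z‖ ≤ (h z).re := by
      have := abs_re_le_norm (h z)
      rw [abs_le] at this
      exact this.1
    linarith [hBC z hz]
  -- log ‖G c‖ ≥ log ‖f c‖ - N log R₂
  have hGc' : Real.log ‖f c‖ - N * Real.log R₂ ≤ Real.log ‖G c‖ := by
    have h1 : Real.log ‖f c‖ ≤ Real.log (R₂ ^ N * ‖G c‖) := Real.log_le_log hfc hGc
    rw [Real.log_mul (pow_pos hR₂0 N).ne' hGcpos.ne', Real.log_pow] at h1
    linarith
  -- log ‖f z‖ = log ‖P z‖ + log ‖G z‖ and log ‖P z‖ = ∑ n u log ‖z - u‖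
  have hPz0 : 0 < ‖P z‖ := by
    rw [hPnorm]; exact Finset.prod_pos fun u hu ↦ pow_pos (hzu0 u hu) _
  have hGz0 : 0 < ‖G z‖ := norm_pos_iff.2 (hG_ne z hzU₂)
  have hfz_eq : Real.log ‖f z‖ = Real.log ‖P z‖ + Real.log ‖G z‖ := by
    rw [hfPG z hzR, norm_mul, Real.log_mul hPz0.ne' hGz0.ne']
  have hlogP : Real.log ‖P z‖ = ∑ u ∈ S, (D u : ℝ) * Real.log ‖z - u‖ := by
    rw [hPnorm, Real.log_prod (s := S) (fun u hu ↦ (pow_pos (hzu0 u hu) _).ne')]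
    refine Finset.sum_congr rfl fun u hu ↦ ?_
    rw [Real.log_pow, hnR u]
  rw [hfz_eq, hlogP, ← hNR]
  have hHdef : 2 * (Real.log (B / ‖f c‖) + (N : ℝ) * Real.log (R / (R - R₂)) + 1) * r₁ / (R₂ - r₁)
      = H := by rw [hH, hM, hM₀]
  rw [hHdef]
  linarith

/-! ## `ζ` on the Jensen discs about `2 + iT` -/

/-- **`log|ζ|` from below near the zeros** (Titchmarsh Thm 9.6 (B), lower half, on the tree's discs):
there is an absolute `A > 0` such that for `|T| ≥ 2`, `|z − (2+iT)| ≤ 7/4`, `0 < δ ≤ 1`, and `z` at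
distance `≥ δ` from every zero of `ζ` in `|s − (2+iT)| ≤ 37/20`,
`log|ζ(z)| ≥ −A (1 + log δ⁻¹) log(|T| + 2)`. (In Titchmarsh's form
`log ζ(s) = ∑_{|t−γ|≤1} log(s−ρ) + O(log t)`, the real part with `|s − ρ| ≥ δ`.)
[cite: Titchmarsh1986, Thm 9.6 (B)] -/
theorem exists_log_norm_riemannZeta_ge_of_far_from_zeros :
    ∃ A : ℝ, 0 < A ∧ ∀ T : ℝ, 2 ≤ |T| → ∀ z ∈ closedBall (2 + T * I) (7 / 4), ∀ δ : ℝ, 0 < δ →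
      δ ≤ 1 →
      (∀ u ∈ Function.support (divisor riemannZeta (closedBall (2 + T * I) (37 / 20))),
        δ ≤ ‖z - u‖) →
      -(A * (1 + Real.log δ⁻¹) * Real.log (|T| + 2)) ≤ Real.log ‖riemannZeta z‖ := by
  classical
  have hlog0 : 0 < Real.log (39 / 37) := Real.log_pos (by norm_num)
  have hlog38 : 0 < Real.log 38 := Real.log_pos (by norm_num)
  refine ⟨300 + 40 * (7 / Real.log (39 / 37)) * Real.log 38, by positivity,
    fun T hT z hz δ hδ hδ1 hfar ↦ ?_⟩
  set κ : ℝ := 7 / Real.log (39 / 37) with hκ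
  have hκ0 : 0 < κ := by positivity
  set c : ℂ := 2 + T * I with hc
  set L : ℝ := Real.log (|T| + 2) with hL
  have hL1 : 1 ≤ L := one_le_log_abs_add_two hT
  have hT0 : 0 ≤ |T| := abs_nonneg T
  -- the data of the disc lemma
  have hf : AnalyticOnNhd ℂ riemannZeta (closedBall c (19 / 10)) :=
    analyticOnNhd_riemannZeta_jensenDisc hT (by norm_num)
  have hc0 : riemannZeta c ≠ 0 := riemannZeta_two_add_ne_zero T
  have hB : ∀ w ∈ closedBall c (19 / 10), ‖riemannZeta w‖ ≤ 40 * (|T| + 4) := fun w hw ↦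
    norm_riemannZeta_le_of_mem_jensenDisc hT (closedBall_subset_closedBall (by norm_num) hw)
  set U₂ := closedBall c (37 / 20) with hU₂
  set D := divisor riemannZeta U₂ with hD
  set S := (D.finiteSupport (isCompact_closedBall c (37 / 20))).toFinset with hS
  -- `ζ z ≠ 0`: otherwise `z` is in the support of the divisor, at distance `0 < δ` from itself
  have hzU₂ : z ∈ U₂ := closedBall_subset_closedBall (by norm_num) hz
  have hf₂ : AnalyticOnNhd ℂ riemannZeta U₂ := hf.mono (closedBall_subset_closedBall (by norm_num))
  have hζz : riemannZeta z ≠ 0 := by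
    intro h0
    have hz1 : z ≠ 1 := jensenDisc_ne_one hT (closedBall_subset_closedBall (by norm_num) hz)
    have hord : 0 < riemannZetaZeroOrder z := (riemannZetaZeroOrder_pos_iff hz1).2 h0
    have hDz : D z = riemannZetaZeroOrder z :=
      (riemannZetaZeroOrder_eq_divisor hf₂.meromorphicOn hzU₂).symm
    have hmem : z ∈ Function.support D := by
      rw [Function.mem_support, hDz]; exact hord.ne'
    have := hfar z hmem
    rw [sub_self, norm_zero] at this
    linarith
  have hmain := log_norm_ge_sum_log_of_zeros (r₁ := 7 / 4) (R₂ := 37 / 20) (R := 19 / 10)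
    (by norm_num) (by norm_num) (by norm_num) hf hc0 hB hz hζz
  -- the ingredients
  have hN := sum_divisor_zetaDisc_le hT
  have hN0 : 0 ≤ ∑ u ∈ S, (D u : ℝ) := by
    refine Finset.sum_nonneg fun u hu ↦ ?_
    have := (zero_of_mem_support_divisor_zetaDisc hT ((Finite.mem_toFinset _).1 hu)).2.1
    exact_mod_cast this.le
  have h13 : 1 / 3 ≤ ‖riemannZeta c‖ := one_third_le_norm_riemannZeta_two_add T
  have hζc0 : 0 < ‖riemannZeta c‖ := by linarith
  -- log(B/|ζ c|) ≤ 7 L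
  have hlogB : Real.log (40 * (|T| + 4) / ‖riemannZeta c‖) ≤ 7 * L := by
    have h1 : 40 * (|T| + 4) / ‖riemannZeta c‖ ≤ 120 * (|T| + 4) := by
      rw [div_le_iff₀ hζc0]; nlinarith
    have h2 : Real.log (40 * (|T| + 4) / ‖riemannZeta c‖) ≤ Real.log (120 * (|T| + 4)) :=
      Real.log_le_log (by positivity) h1
    linarith [log_jensenBound_le hT]
  -- log |ζ c| ≥ -log 3 ≥ -2
  have hlogc : -2 ≤ Real.log ‖riemannZeta c‖ := by
    have h1 : Real.log (1 / 3) ≤ Real.log ‖riemannZeta c‖ := Real.log_le_log (by norm_num) h13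
    have h2 : Real.log (1 / 3) = -Real.log 3 := by
      rw [one_div, Real.log_inv]
    have h3 : Real.log 3 ≤ 2 := by
      rw [← Real.log_exp 2]
      refine Real.log_le_log (by norm_num) ?_
      have := Real.exp_one_gt_d9
      have h4 : Real.exp 2 = Real.exp 1 * Real.exp 1 := by rw [← Real.exp_add]; norm_num
      nlinarith
    linarith
  -- the sum over zeros: each log ‖z - u‖ ≥ log δ = -log δ⁻¹
  have hlogδ : 0 ≤ Real.log δ⁻¹ := Real.log_nonneg ((one_le_inv₀ hδ).2 hδ1)
  have hsum : -(∑ u ∈ S, (D u : ℝ)) * Real.log δ⁻¹ ≤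
      ∑ u ∈ S, (D u : ℝ) * Real.log ‖z - u‖ := by
    have e : -(∑ u ∈ S, (D u : ℝ)) * Real.log δ⁻¹ = ∑ u ∈ S, (D u : ℝ) * Real.log δ := by
      rw [Real.log_inv, mul_neg, neg_mul, neg_neg, Finset.sum_mul]
    rw [e]
    refine Finset.sum_le_sum fun u hu ↦ ?_
    have hu' := (Finite.mem_toFinset _).1 hu
    have hpos := (zero_of_mem_support_divisor_zetaDisc hT hu').2.1
    have hDu : (0 : ℝ) ≤ (D u : ℝ) := by exact_mod_cast hpos.le
    have h1 : Real.log δ ≤ Real.log ‖z - u‖ := Real.log_le_log hδ (hfar u hu')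
    exact mul_le_mul_of_nonneg_left h1 hDu
  have hR1 : Real.log ((37 : ℝ) / 20) ≤ Real.log 38 := Real.log_le_log (by norm_num) (by norm_num)
  have hR2 : Real.log ((19 : ℝ) / 10 / (19 / 10 - 37 / 20)) = Real.log 38 := by norm_num
  rw [hR2] at hmain
  -- assemble: everything is ≥ -(A (1 + log δ⁻¹)) L
  have hNle : ∑ u ∈ S, (D u : ℝ) ≤ κ * L := hN
  set Ns := ∑ u ∈ S, (D u : ℝ) with hNs
  set X := Real.log δ⁻¹ with hX
  set ℓ := Real.log 38 with hℓ
  have hℓ1 : 1 ≤ ℓ := by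
    rw [hℓ, ← Real.log_exp 1]
    refine Real.log_le_log (Real.exp_pos 1) ?_
    have := Real.exp_one_lt_d9
    linarith
  have hL0 : 0 ≤ L := by linarith
  have hNs38 : Ns * ℓ ≤ κ * L * ℓ := mul_le_mul_of_nonneg_right hNle hlog38.le
  have hNs37 : Ns * Real.log (37 / 20) ≤ κ * L * ℓ := by
    calc Ns * Real.log (37 / 20) ≤ Ns * ℓ := mul_le_mul_of_nonneg_left hR1 hN0
      _ ≤ κ * L * ℓ := hNs38
  have hNsδ : Ns * X ≤ κ * L * X := mul_le_mul_of_nonneg_right hNle hlogδ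
  -- the lower bound of the four terms
  have hT1 : -(κ * L * X) ≤ ∑ u ∈ S, (D u : ℝ) * Real.log ‖z - u‖ := by
    have : -(Ns * X) ≤ ∑ u ∈ S, (D u : ℝ) * Real.log ‖z - u‖ := by
      have e : -(Ns * X) = -Ns * X := by ring
      rw [e]; exact hsum
    linarith
  have hT4 : 2 * (Real.log (40 * (|T| + 4) / ‖riemannZeta c‖) + Ns * ℓ + 1) * (7 / 4)
      / (37 / 20 - 7 / 4) ≤ 35 * (8 * L + κ * L * ℓ) := by
    have e1 : (2 : ℝ) * (Real.log (40 * (|T| + 4) / ‖riemannZeta c‖) + Ns * ℓ + 1) * (7 / 4)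
        / (37 / 20 - 7 / 4) = 35 * (Real.log (40 * (|T| + 4) / ‖riemannZeta c‖) + Ns * ℓ + 1) := by
      ring
    rw [e1]
    have : Real.log (40 * (|T| + 4) / ‖riemannZeta c‖) + Ns * ℓ + 1 ≤ 8 * L + κ * L * ℓ := by
      linarith
    linarith
  -- the target constant dominates
  have hdom : κ * L * X + 2 * L + κ * L * ℓ + 35 * (8 * L + κ * L * ℓ) ≤
      (300 + 40 * κ * ℓ) * (1 + X) * L := by
    have e : (300 + 40 * κ * ℓ) * (1 + X) * L =
        (300 + 40 * κ * ℓ) * L + (300 + 40 * κ * ℓ) * (X * L) := by ring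
    rw [e]
    have hXL : 0 ≤ X * L := mul_nonneg hlogδ hL0
    have h1 : κ * L * X ≤ (300 + 40 * κ * ℓ) * (X * L) := by
      have e2 : κ * L * X = κ * (X * L) := by ring
      rw [e2]
      refine mul_le_mul_of_nonneg_right ?_ hXL
      nlinarith [hκ0.le, hℓ1]
    have h2 : 2 * L + κ * L * ℓ + 35 * (8 * L + κ * L * ℓ) = (282 + 36 * (κ * ℓ)) * L := by ring
    have hκℓ : 0 ≤ κ * ℓ := by positivity
    have h3 : (282 + 36 * (κ * ℓ)) * L ≤ (300 + 40 * κ * ℓ) * L := by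
      refine mul_le_mul_of_nonneg_right ?_ hL0
      nlinarith
    linarith
  have key : -((300 + 40 * κ * ℓ) * (1 + X) * L) ≤
      (∑ u ∈ S, (D u : ℝ) * Real.log ‖z - u‖) + Real.log ‖riemannZeta c‖
        - Ns * Real.log (37 / 20)
        - 2 * (Real.log (40 * (|T| + 4) / ‖riemannZeta c‖) + Ns * ℓ + 1) * (7 / 4)
            / (37 / 20 - 7 / 4) := by
    have h2L : -(2 * L) ≤ Real.log ‖riemannZeta c‖ := by linarith
    linarith [hT1, h2L, hNs37, hT4, hdom]
  exact key.trans hmain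

/-! ## Zero-free strips -/

/-- **Levinson's (4.1) / Titchmarsh 9.6 (B), consequence.** If `ζ(s) ≠ 0` for
`a − δ < Re s < b + δ` (`0 < δ`, `1/4 ≤ a`, `b ≤ 15/4`), then there is `A > 0` with
`log|ζ(σ + it)| ≥ −A log(|t| + 2)` for all `a ≤ σ ≤ b` and `|t| ≥ 2`: every zero of `ζ` near
`σ + it` has real part outside the open strip, hence is at distance `≥ min(δ,1)` from `σ + it`.
[cite: Levinson1956, §4 (4.1)] [cite: Titchmarsh1986, Thm 9.6 (B)] -/
theorem exists_log_norm_riemannZeta_ge_of_zeroFree_strip {a b δ : ℝ} (hδ : 0 < δ)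
    (ha : 1 / 4 ≤ a) (hb : b ≤ 15 / 4)
    (hZ : ∀ s : ℂ, a - δ < s.re → s.re < b + δ → riemannZeta s ≠ 0) :
    ∃ A : ℝ, 0 < A ∧ ∀ σ ∈ Icc a b, ∀ t : ℝ, 2 ≤ |t| →
      -(A * Real.log (|t| + 2)) ≤ Real.log ‖riemannZeta (σ + t * I)‖ := by
  obtain ⟨A, hA, h⟩ := exists_log_norm_riemannZeta_ge_of_far_from_zeros
  set δ' : ℝ := min δ 1 with hδ'
  have hδ'0 : 0 < δ' := lt_min hδ one_pos
  have hδ'1 : δ' ≤ 1 := min_le_right _ _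
  have hδ'δ : δ' ≤ δ := min_le_left _ _
  refine ⟨A * (1 + Real.log δ'⁻¹), by
    have : 0 ≤ Real.log δ'⁻¹ := Real.log_nonneg ((one_le_inv₀ hδ'0).2 hδ'1)
    positivity, fun σ hσ t ht ↦ ?_⟩
  have hz : (σ : ℂ) + t * I ∈ closedBall (2 + t * I) (7 / 4) := by
    rw [mem_closedBall, dist_eq_norm]
    have e : (σ : ℂ) + t * I - (2 + t * I) = ((σ - 2 : ℝ) : ℂ) := by push_cast; ring
    rw [e, Complex.norm_real, Real.norm_eq_abs, abs_le]
    constructor <;> linarith [hσ.1, hσ.2]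
  refine h t ht _ hz δ' hδ'0 hδ'1 fun u hu ↦ ?_
  have hu := zero_of_mem_support_divisor_zetaDisc ht hu
  -- `Re u ∉ (a - δ, b + δ)`
  have hre : u.re ≤ a - δ ∨ b + δ ≤ u.re := by
    by_contra hcon
    push Not at hcon
    exact hZ u hcon.1 hcon.2 hu.1
  have h1 : |((σ : ℂ) + t * I - u).re| ≤ ‖(σ : ℂ) + t * I - u‖ := abs_re_le_norm _
  have h2 : ((σ : ℂ) + t * I - u).re = σ - u.re := by simp
  rw [h2] at h1
  refine le_trans ?_ h1
  rcases hre with h3 | h3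
  · rw [abs_of_nonneg (by linarith [hσ.1])]; linarith [hσ.1]
  · rw [abs_of_nonpos (by linarith [hσ.2])]; linarith [hσ.2]

/-- **`1/ζ` has polynomial growth in a zero-free strip** (all heights): if `ζ(s) ≠ 0` for
`a − δ < Re s < b + δ` with `0 < δ`, `1/4 ≤ a ≤ b < 1`, then `|1/ζ(σ + it)| ≤ C (|t| + 2)^C` for all
`a ≤ σ ≤ b` and all real `t` (for `|t| ≤ 2` by compactness and continuity of `ζ` off `s = 1`).
This is the form `|ζ(s)| > (2 + |t|)^{−A}` of [Levinson1956, (4.1)]. [cite: Levinson1956, §4 (4.1)] -/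
theorem exists_norm_inv_riemannZeta_le_of_zeroFree_strip {a b δ : ℝ} (hδ : 0 < δ)
    (ha : 1 / 4 ≤ a) (hab : a ≤ b) (hb : b < 1)
    (hZ : ∀ s : ℂ, a - δ < s.re → s.re < b + δ → riemannZeta s ≠ 0) :
    ∃ C : ℝ, 0 < C ∧ ∀ σ ∈ Icc a b, ∀ t : ℝ,
      ‖(riemannZeta (σ + t * I))⁻¹‖ ≤ C * (|t| + 2) ^ C := by
  obtain ⟨A, hA, hlog⟩ := exists_log_norm_riemannZeta_ge_of_zeroFree_strip hδ ha
    (by linarith) hZ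
  -- compact part: `|t| ≤ 2`
  set K : Set ℂ := Icc a b ×ℂ Icc (-2 : ℝ) 2 with hK
  have hKc : IsCompact K := isCompact_Icc.reProdIm isCompact_Icc
  have hK1 : ∀ s ∈ K, s ≠ 1 := by
    intro s hs h1
    have := hs.1.2
    rw [h1, one_re] at this
    linarith
  have hKζ : ∀ s ∈ K, riemannZeta s ≠ 0 := fun s hs ↦
    hZ s (by linarith [hs.1.1]) (by linarith [hs.1.2])
  have hcont : ContinuousOn (fun s ↦ (riemannZeta s)⁻¹) K := by
    refine ContinuousOn.inv₀ (fun s hs ↦ ?_) hKζ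
    exact (differentiableAt_riemannZeta (hK1 s hs)).continuousAt.continuousWithinAt
  obtain ⟨C₀, hC₀⟩ := hKc.exists_bound_of_continuousOn hcont
  have hC₀0 : 0 ≤ C₀ := le_trans (norm_nonneg _) (hC₀ (a : ℂ) ⟨by simp [hab], by simp⟩)
  refine ⟨A + C₀ + 1, by positivity, fun σ hσ t ↦ ?_⟩
  have hbase : 1 ≤ |t| + 2 := by linarith [abs_nonneg t]
  have hpow1 : 1 ≤ (|t| + 2) ^ (A + C₀ + 1) := Real.one_le_rpow hbase (by positivity)
  rcases le_or_gt 2 |t| with ht | ht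
  · -- `|t| ≥ 2`: exponentiate the log bound
    have hne : riemannZeta (σ + t * I) ≠ 0 := hZ _ (by simp; linarith [hσ.1]) (by simp; linarith [hσ.2])
    have hpos : 0 < ‖riemannZeta (σ + t * I)‖ := norm_pos_iff.2 hne
    have h1 := hlog σ hσ t ht
    have h2 : ‖(riemannZeta (σ + t * I))⁻¹‖ ≤ (|t| + 2) ^ A := by
      rw [norm_inv, ← Real.exp_log hpos, ← Real.exp_neg, Real.rpow_def_of_pos (by positivity),
        Real.exp_le_exp]
      linarith
    have h3 : (|t| + 2) ^ A ≤ (|t| + 2) ^ (A + C₀ + 1) :=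
      Real.rpow_le_rpow_of_exponent_le hbase (by linarith)
    calc ‖(riemannZeta (σ + t * I))⁻¹‖ ≤ (|t| + 2) ^ (A + C₀ + 1) := h2.trans h3
      _ ≤ (A + C₀ + 1) * (|t| + 2) ^ (A + C₀ + 1) := by
          apply le_mul_of_one_le_left (by positivity); linarith
  · have hmem : (σ : ℂ) + t * I ∈ K := by
      refine ⟨by simpa using hσ, ?_⟩
      simp only [mem_preimage, add_im, ofReal_im, mul_im, ofReal_re, I_im, mul_one, I_re,
        mul_zero, add_zero, zero_add, mem_Icc]
      constructor <;> linarith [abs_lt.1 ht]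
    calc ‖(riemannZeta (σ + t * I))⁻¹‖ ≤ C₀ := hC₀ _ hmem
      _ ≤ (A + C₀ + 1) * 1 := by linarith
      _ ≤ (A + C₀ + 1) * (|t| + 2) ^ (A + C₀ + 1) := by gcongr

end ZetaStripLowerBound

end Literature.NumberTheory.LFunctions

end
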